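import Mathlib
import Summits.KontsevichZagierPeriods.KontsevichZagierPeriods.Theorems.InverseLandauTateLiftingRotationSector
import Summits.KontsevichZagierPeriods.KontsevichZagierPeriods.Theorems.InverseLandauTateLiftingRadialBand
import Summits.KontsevichZagierPeriods.KontsevichZagierPeriods.Theorems.InverseLandauTateLiftingIsotropyPlane
import Summits.KontsevichZagierPeriods.KontsevichZagierPeriods.Theorems.InverseLandauTateLiftingVolumeFormLift
import Summits.KontsevichZagierPeriods.KontsevichZagierPeriods.Theorems.InverseLandauTateLiftingTranscSector
import Summits.KontsevichZagierPeriods.KontsevichZagierPeriods.Theorems.InverseLandauTateLiftingForms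
import Literature.NumberTheory.Transcendental.LindemannWeierstrassProofs

/-!
# `TateLifting` (stmt-KontsevichZagierPeriods-9129), line `Sketch` — the ROTATION SECTOR (assembly II):
# balls of every dimension, hard-disc configuration integrals, the volume normal form of the crux

Sequel to `Theorems/InverseLandauTateLiftingRotationSector.lean` (continuation lead c8):

* `ball_mem_piSubring` — the classes of the RADIAL BALL REPRESENTATIONS `[B̄_n, P(|x|²)]` (`B̄_n` the CLOSED
  unit ball of ANY dimension `n`, `P ∈ K[X]`, `K = ℚ̄ ∩ ℝ`) lie in the subring `K₀[⟦π⟧]` of the formal period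
  ring generated by the dimension-zero classes and the disc: induction `n ↦ n + 2` — the meridian of
  `[B̄_{n+2}, P(|x|²)]` is one Newton–Leibniz move away from `[B̄_n, Q(|v|²)]` (`tateLifting_radialBand`), so
  `⟦B̄_{n+2}, P⟧ = ⟦B̄_n, Q⟧·⟦π⟧` (`rotation_reduce`). In particular `vol B̄_n ∈ ℚ π^{⌊n/2⌋}` inside the rules,
  with no Beta-function / Dirichlet hypothesis;
* `ballKernel`, `kzPeriodConjecture_ball` — **Conjecture 1 (kernel form) on the radial balls of all
  dimensions, the points and the disc** (Lindemann read in the formal period ring, `transcRingKernel`): any two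
  radial ball representations — of any two dimensions — with the same value are KZ-equivalent;
* `hardDiscKernel` — the KERNEL TRANSFER for `O(2)`-invariant hard-disc configuration volumes in `(ℝ²)³`
  through the plane engine `tateLifting_isotropyPlane` (= HardSphereVirial's `IsotropyFactorisation2`);
* `tateLifting_iff_volumeForm`, `kzKernelConjecture_iff_volumeConjectureCompact` — the VOLUME NORMAL FORM of
  the crux and of the summit (`tateLifting_volumeFormLift`, Cresson–Viu-Sos over the tree's
  `KZ.semiCanonicalReduction_holds`).

References: M. Kontsevich, D. Zagier, *Periods* (2001), §1.2, §4.1; F. Lindemann (1882) through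
`transcendental_pi_holds`; J. Cresson, J. Viu-Sos, *On the equality of periods of Kontsevich–Zagier*, JTNB 34
(2022), §1 p. 326.
-/

noncomputable section

open MeasureTheory Set
open Literature.NumberTheory.Transcendental
open Literature.ModelTheory.ExponentialFields (IsSemialgebraic)
open Summit.KontsevichZagierPeriods.KontsevichZagierPeriods.Theses.InverseLandau (TateLifting)

namespace Summit.KontsevichZagierPeriods.InverseLandau

/-! ## Closed unit balls of every dimension with radial polynomial integrands -/

namespace RotationBalls

/-- `|x|²` splits off its last two coordinates. [folklore] -/
theorem sum_sq_eq_init_init {n : ℕ} (x : Fin (n + 2) → ℝ) :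
    ∑ i, x i ^ 2 = ∑ i, (Fin.init (Fin.init x : Fin (n + 1) → ℝ) : Fin n → ℝ) i ^ 2 +
      (Fin.init x : Fin (n + 1) → ℝ) (Fin.last n) ^ 2 + x (Fin.last (n + 1)) ^ 2 := by
  rw [Fin.sum_univ_castSucc, Fin.sum_univ_castSucc]
  rfl

/-- A radial ball representation of dimension `n + 2` is invariant under the rotations of its last two
coordinates. [folklore] -/
theorem rotInvariant_ball {n : ℕ} (P : Polynomial (algebraicClosure ℚ ℝ)) (r : KZ.IntegralRep (n + 2))
    (hdom : r.domain = {x | ∑ i, x i ^ 2 ≤ 1})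
    (hint : Set.EqOn r.integrand (fun x => (Polynomial.aeval (∑ i, x i ^ 2) P : ℝ)) r.domain) :
    ∀ x ∈ r.domain, ∀ c s : ℝ, c ^ 2 + s ^ 2 = 1 →
      (Fin.snoc (Fin.snoc (Fin.init (Fin.init x : Fin (n + 1) → ℝ) : Fin n → ℝ)
          (c * (Fin.init x : Fin (n + 1) → ℝ) (Fin.last n) - s * x (Fin.last (n + 1))) :
            Fin (n + 1) → ℝ)
          (s * (Fin.init x : Fin (n + 1) → ℝ) (Fin.last n) + c * x (Fin.last (n + 1))) :
          Fin (n + 2) → ℝ) ∈ r.domain ∧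
      r.integrand (Fin.snoc (Fin.snoc (Fin.init (Fin.init x : Fin (n + 1) → ℝ) : Fin n → ℝ)
          (c * (Fin.init x : Fin (n + 1) → ℝ) (Fin.last n) - s * x (Fin.last (n + 1))) :
            Fin (n + 1) → ℝ)
          (s * (Fin.init x : Fin (n + 1) → ℝ) (Fin.last n) + c * x (Fin.last (n + 1))) :
          Fin (n + 2) → ℝ) = r.integrand x := by
  intro x hx c s hcs
  have key : ∀ y z : ℝ, (c * y - s * z) ^ 2 + (s * y + c * z) ^ 2 = y ^ 2 + z ^ 2 := fun y z => by
    linear_combination (y ^ 2 + z ^ 2) * hcs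
  have hsum : ∑ i, (Fin.snoc (Fin.snoc (Fin.init (Fin.init x : Fin (n + 1) → ℝ) : Fin n → ℝ)
        (c * (Fin.init x : Fin (n + 1) → ℝ) (Fin.last n) - s * x (Fin.last (n + 1))) :
          Fin (n + 1) → ℝ)
        (s * (Fin.init x : Fin (n + 1) → ℝ) (Fin.last n) + c * x (Fin.last (n + 1))) :
        Fin (n + 2) → ℝ) i ^ 2 = ∑ i, x i ^ 2 := by
    rw [sum_sq_eq_init_init, sum_sq_eq_init_init x]
    simp only [Fin.init_snoc, Fin.snoc_last, add_assoc, key]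
  have hmem : (Fin.snoc (Fin.snoc (Fin.init (Fin.init x : Fin (n + 1) → ℝ) : Fin n → ℝ)
        (c * (Fin.init x : Fin (n + 1) → ℝ) (Fin.last n) - s * x (Fin.last (n + 1))) :
          Fin (n + 1) → ℝ)
        (s * (Fin.init x : Fin (n + 1) → ℝ) (Fin.last n) + c * x (Fin.last (n + 1))) :
        Fin (n + 2) → ℝ) ∈ r.domain := by
    rw [hdom] at hx ⊢
    simp only [Set.mem_setOf_eq, hsum]
    exact hx
  exact ⟨hmem, by simp only [hint hmem, hint hx, hsum]⟩

end RotationBalls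

open RotationBalls

/-- **THE CLASSES OF THE RADIAL BALL REPRESENTATIONS LIE IN `K₀[⟦π⟧]`**, every dimension: induction
`n ↦ n + 2` — `⟦B̄_{n+2}, P(|x|²)⟧ = ⟦B̄_n, Q(|v|²)⟧ · ⟦π⟧` by the rotation reduction and the radial
Newton–Leibniz step (`tateLifting_radialBand` (a)); dimension `0` is a point and dimension `1` is a point
modulo relations (`tateLifting_radialBand` (b)). In particular `vol B̄_n ∈ ℚ π^{⌊n/2⌋}` inside the rules.
[cite: KontsevichZagier2001, §1.2] -/
theorem ball_mem_piSubring :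
    ∀ (n : ℕ) (P : Polynomial (algebraicClosure ℚ ℝ)) (r : KZ.IntegralRep n),
      r.domain = {x | ∑ i, x i ^ 2 ≤ 1} →
      Set.EqOn r.integrand (fun x => (Polynomial.aeval (∑ i, x i ^ 2) P : ℝ)) r.domain →
      KZ.toFormalPeriod (KZ.of r) ∈ Subring.closure
        (Set.range (fun b : KZ.IntegralRep 0 => KZ.toFormalPeriod (KZ.of b)) ∪
          {KZ.toFormalPeriod (KZ.of KZ.piRep)}) := by
  intro n
  induction n using Nat.twoStepInduction with
  | zero =>
    intro P r _ _
    exact Subring.subset_closure (Or.inl ⟨r, rfl⟩)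
  | one =>
    intro P r hdom hint
    obtain ⟨r₀, -, hrel⟩ := tateLifting_radialBand.2 P r hdom hint
    rw [KZ.toFormalPeriod_eq_iff.2 hrel]
    exact Subring.subset_closure (Or.inl ⟨r₀, rfl⟩)
  | more n ih _ =>
    intro P r hdom hint
    obtain ⟨m, hmd, hmi, hred⟩ := rotation_reduce r (rotInvariant_ball P r hdom hint)
    have hmd' : m.domain = {p | 0 < p (Fin.last n) ∧
        ∑ i, (Fin.init p : Fin n → ℝ) i ^ 2 + p (Fin.last n) ^ 2 ≤ 1} := by
      rw [hmd, hdom]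
      ext p
      simp only [Set.mem_setOf_eq, sum_sq_eq_init_init, Fin.init_snoc, Fin.snoc_last]
      constructor
      · rintro ⟨hρ, h⟩; exact ⟨hρ, by nlinarith⟩
      · rintro ⟨hρ, h⟩; exact ⟨hρ, by nlinarith⟩
    have hmi' : Set.EqOn m.integrand (fun p => 2 * p (Fin.last n) *
        (Polynomial.aeval (∑ i, (Fin.init p : Fin n → ℝ) i ^ 2 + p (Fin.last n) ^ 2) P : ℝ)) m.domain := by
      intro p hp
      have hp' : (Fin.snoc p 0 : Fin (n + 2) → ℝ) ∈ r.domain := by rw [hmd] at hp; exact hp.2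
      simp only [hmi, hint hp', sum_sq_eq_init_init, Fin.init_snoc, Fin.snoc_last]
      ring_nf
    obtain ⟨Q, b, hbd, hbi, hmb⟩ := tateLifting_radialBand.1 n P m hmd' hmi'
    have hb : KZ.toFormalPeriod (KZ.of b) ∈ Subring.closure
        (Set.range (fun b : KZ.IntegralRep 0 => KZ.toFormalPeriod (KZ.of b)) ∪
          {KZ.toFormalPeriod (KZ.of KZ.piRep)}) :=
      ih Q b hbd (by rw [hbi]; exact fun _ _ => rfl)
    have hcls : KZ.toFormalPeriod (KZ.of r) =
        KZ.toFormalPeriod (KZ.of b) * KZ.toFormalPeriod (KZ.of KZ.piRep) := by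
      rw [← map_mul]
      refine KZ.toFormalPeriod_eq_iff.2 ?_
      have h1 : KZ.of m * KZ.of KZ.piRep - KZ.of b * KZ.of KZ.piRep ∈ KZ.relations := by
        rw [← sub_mul]; exact KZ.mul_mem_relations_right_holds _ _ hmb
      have : KZ.of r - KZ.of b * KZ.of KZ.piRep =
          (KZ.of r - KZ.of m * KZ.of KZ.piRep) + (KZ.of m * KZ.of KZ.piRep - KZ.of b * KZ.of KZ.piRep) := by
        abel
      rw [this]
      exact KZ.relations.add_mem hred h1
    rw [hcls]
    exact Subring.mul_mem _ hb (Subring.subset_closure (Or.inr rfl))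

/-- **CONJECTURE 1 ON THE RADIAL BALLS OF ALL DIMENSIONS, THE POINTS AND THE DISC (kernel form).** Every
vanishing `ℤ`-combination of radial ball representations `[B̄_n, P(|x|²)]` (all `n`, `P ∈ K[X]`), point
representations and the disc `[π]` is a relation of the Kontsevich–Zagier calculus — Lindemann read in the
formal period ring (`transcRingKernel` at the family `(⟦π⟧)`). E.g. `2·[B̄₄] − [disc × disc]`-type and
`3·[B̄₃] − 4·[pt × disc]`-type identities, once the volumes are computed, are derivable by the moves.
[cite: KontsevichZagier2001, §1.2] -/
theorem ballKernel :
    ∀ c ∈ AddSubgroup.closure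
        ({d : KZ.FormalRep | ∃ (n : ℕ) (P : Polynomial (algebraicClosure ℚ ℝ)) (r : KZ.IntegralRep n),
            r.domain = {x | ∑ i, x i ^ 2 ≤ 1} ∧
            Set.EqOn r.integrand (fun x => (Polynomial.aeval (∑ i, x i ^ 2) P : ℝ)) r.domain ∧ d = KZ.of r} ∪
          {d : KZ.FormalRep | ∃ r : KZ.IntegralRep 0, d = KZ.of r} ∪ {KZ.of KZ.piRep}),
      KZ.eval c = 0 → c ∈ KZ.relations := by
  intro c hc h0
  have hx : AlgebraicIndependent ℚ fun i : Fin 1 =>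
      KZ.evalP ((![KZ.toFormalPeriod (KZ.of KZ.piRep)] : Fin 1 → KZ.FormalPeriodRing) i) := by
    have : (fun i : Fin 1 => KZ.evalP ((![KZ.toFormalPeriod (KZ.of KZ.piRep)] :
        Fin 1 → KZ.FormalPeriodRing) i)) = ![Real.pi] := by
      ext i; fin_cases i; simp [KZ.piRep_value]
    rw [this]
    exact algebraicIndependent_iff_transcendental.2 transcendental_pi_holds
  refine KZ.toFormalPeriod_eq_zero_iff.1 (transcRingKernel _ hx _ ?_ (by rw [KZ.evalP_toFormalPeriod, h0]))
  have hsub : Set.range (fun b : KZ.IntegralRep 0 => KZ.toFormalPeriod (KZ.of b)) ∪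
      {KZ.toFormalPeriod (KZ.of KZ.piRep)} ⊆
      Set.range (fun b : KZ.IntegralRep 0 => KZ.toFormalPeriod (KZ.of b)) ∪
        Set.range (![KZ.toFormalPeriod (KZ.of KZ.piRep)] : Fin 1 → KZ.FormalPeriodRing) := by
    refine Set.union_subset_union_right _ ?_
    rintro _ rfl
    exact ⟨0, by simp⟩
  refine Subring.closure_mono hsub ?_
  refine AddSubgroup.closure_induction (p := fun c _ => KZ.toFormalPeriod c ∈ Subring.closure
    (Set.range (fun b : KZ.IntegralRep 0 => KZ.toFormalPeriod (KZ.of b)) ∪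
      {KZ.toFormalPeriod (KZ.of KZ.piRep)})) ?_ ?_ ?_ ?_ hc
  · rintro d ((⟨n, P, r, hdom, hint, rfl⟩ | ⟨r, rfl⟩) | rfl)
    · exact ball_mem_piSubring n P r hdom hint
    · exact Subring.subset_closure (Or.inl ⟨r, rfl⟩)
    · exact Subring.subset_closure (Or.inr rfl)
  · rw [map_zero]; exact Subring.zero_mem _
  · intro x y _ _ hx hy
    rw [map_add]; exact Subring.add_mem _ hx hy
  · intro x _ hx
    rw [map_neg]; exact Subring.neg_mem _ hx

/-- **Two radial ball representations (any two dimensions) with the same value are KZ-equivalent.**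
[cite: KontsevichZagier2001, §1.2] -/
theorem kzPeriodConjecture_ball {n m : ℕ} (P P' : Polynomial (algebraicClosure ℚ ℝ))
    (r : KZ.IntegralRep n) (r' : KZ.IntegralRep m)
    (hr : r.domain = {x | ∑ i, x i ^ 2 ≤ 1})
    (hri : Set.EqOn r.integrand (fun x => (Polynomial.aeval (∑ i, x i ^ 2) P : ℝ)) r.domain)
    (hr' : r'.domain = {x | ∑ i, x i ^ 2 ≤ 1})
    (hri' : Set.EqOn r'.integrand (fun x => (Polynomial.aeval (∑ i, x i ^ 2) P' : ℝ)) r'.domain)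
    (hv : r.value = r'.value) : KZ.Equivalent r r' :=
  ballKernel _
    (sub_mem (AddSubgroup.subset_closure (Or.inl (Or.inl ⟨n, P, r, hr, hri, rfl⟩)))
      (AddSubgroup.subset_closure (Or.inl (Or.inl ⟨m, P', r', hr', hri', rfl⟩))))
    (by rw [map_sub, KZ.eval_of, KZ.eval_of, hv, sub_self])

/-! ## Hard-disc configuration integrals (the plane engine) -/

/-- **KERNEL FORM ON THE HARD-DISC CONFIGURATION INTEGRALS.** Let `S`, `B` be sets of formal combinations
such that every element of `B` is the class of an integrand-`1` representation over a `ℚ`-semialgebraic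
`σ ⊆ (ℝ²)³` invariant under the diagonal action of `O(2)`, together with an honest reduced configuration
representation `t = [{(ρ, y₃, y₄) | ρ > 0, ((ρ,0), y₃, y₄) ∈ σ}, 2ρ]` reducing to `closure S`. If Conjecture 1
(kernel form) holds on `closure S`, it holds on `closure B`: `[σ, 1] ≡ [t]·[disc]` by the plane engine
`tateLifting_isotropyPlane` applied to the honest product `[ℝ, du/(1+u²)] × t`. [cite: KontsevichZagier2001, §1.2] -/
theorem hardDiscKernel (S B : Set KZ.FormalRep)
    (hB : ∀ d ∈ B, ∃ (σ : Set (Fin 6 → ℝ)) (r : KZ.IntegralRep 6) (t : KZ.IntegralRep 5),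
      IsSemialgebraic ℚ σ ∧
      (∀ R : Matrix (Fin 2) (Fin 2) ℝ, R.transpose * R = 1 → ∀ x : Fin 6 → ℝ,
        x ∈ σ ↔ (![(R.mulVec ![x 0, x 1]) 0, (R.mulVec ![x 0, x 1]) 1, (R.mulVec ![x 2, x 3]) 0,
          (R.mulVec ![x 2, x 3]) 1, (R.mulVec ![x 4, x 5]) 0, (R.mulVec ![x 4, x 5]) 1] : Fin 6 → ℝ) ∈ σ) ∧
      r.domain = σ ∧ (∀ x ∈ r.domain, r.integrand x = 1) ∧
      t.domain = {p | 0 < p 0 ∧ (![p 0, 0, p 1, p 2, p 3, p 4] : Fin 6 → ℝ) ∈ σ} ∧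
      Set.EqOn t.integrand (fun p => 2 * p 0) t.domain ∧
      (∃ ℓ ∈ AddSubgroup.closure S, KZ.of t - ℓ ∈ KZ.relations) ∧ d = KZ.of r)
    (hK : ∀ c ∈ AddSubgroup.closure S, KZ.eval c = 0 → c ∈ KZ.relations) :
    ∀ c ∈ AddSubgroup.closure B, KZ.eval c = 0 → c ∈ KZ.relations := by
  refine RotationSector.kernel_of_reduce_mul (KZ.of KZ.piRep) (by rw [KZ.eval_of_piRep]; exact Real.pi_ne_zero)
    (fun d hd => ?_) hK
  obtain ⟨σ, r, t, hσ, hO, hrd, hri, htd, hti, ⟨ℓ, hℓ, htℓ⟩, rfl⟩ := hB d hd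
  obtain ⟨c, hcd, hci⟩ := RotationSplit.exists_arctanRep_univ
  refine ⟨ℓ, hℓ, ?_⟩
  have hq := tateLifting_isotropyPlane σ hσ hO r hrd hri (c.prod t) ?_ ?_
  · have h1 : KZ.of (c.prod t) - KZ.of t * KZ.of c ∈ KZ.relations := by
      rw [← KZ.of_mul_of]; exact KZ.mul_sub_mul_comm_mem_relations _ _
    have h2 : KZ.of t * KZ.of c - KZ.of t * KZ.of KZ.piRep ∈ KZ.relations := by
      rw [← mul_sub]
      exact KZ.of_mul_mem_relations t (RotationSector.arctan_sub_piRep_mem_relations c hcd hci)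
    have h3 : KZ.of t * KZ.of KZ.piRep - ℓ * KZ.of KZ.piRep ∈ KZ.relations := by
      rw [← sub_mul]; exact KZ.mul_mem_relations_right_holds _ _ htℓ
    have : KZ.of r - ℓ * KZ.of KZ.piRep = (KZ.of r - KZ.of (c.prod t)) +
        (KZ.of (c.prod t) - KZ.of t * KZ.of c) + (KZ.of t * KZ.of c - KZ.of t * KZ.of KZ.piRep) +
        (KZ.of t * KZ.of KZ.piRep - ℓ * KZ.of KZ.piRep) := by abel
    rw [this]
    exact KZ.relations.add_mem (KZ.relations.add_mem (KZ.relations.add_mem hq h1) h2) h3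
  · rw [KZ.IntegralRep.prod_domain]
    ext w
    simp only [KZ.IntegralRep.mem_prodDomain, hcd, Set.mem_univ, true_and, htd, Set.mem_setOf_eq]
    rfl
  · intro w hw
    rw [KZ.IntegralRep.prod_integrand_eq, KZ.IntegralRep.prodFun_apply, hci]
    rw [KZ.IntegralRep.prod_domain, KZ.IntegralRep.mem_prodDomain] at hw
    rw [hti hw.2]
    show (1 : ℝ) / (1 + w 0 ^ 2) * (2 * w 1) = 2 / (1 + w 0 ^ 2) * w 1
    ring

/-! ## The volume normal form of the crux -/

/-- **THE VOLUME NORMAL FORM OF THE CRUX.** `TateLifting` holds iff any two representations of one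
dimension with compact domains of non-empty interior, integrand `1` and the same volume differ, in the
formal group, by an element of `relations ⊔ closure T` (`T` the Tate fibres) — `tateLifting_volumeFormLift`
at `G = relations ⊔ closure T` (Tate fibres have value `0`). [cite: CressonViusos2022, §1 p. 326] -/
theorem tateLifting_iff_volumeForm :
    TateLifting ↔ ∀ (d : ℕ) (K₁ K₂ : KZ.IntegralRep d),
      IsCompact K₁.domain → (interior K₁.domain).Nonempty →
      IsCompact K₂.domain → (interior K₂.domain).Nonempty →
      (∀ x ∈ K₁.domain, K₁.integrand x = 1) → (∀ x ∈ K₂.domain, K₂.integrand x = 1) →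
      K₁.value = K₂.value →
      KZ.of K₁ - KZ.of K₂ ∈ KZ.relations ⊔ AddSubgroup.closure {d : KZ.FormalRep |
        ∃ (n : ℕ) (P Q : MvPolynomial (Fin (n + 1)) ℚ) (ε ϖ₀ : ℝ) (r : KZ.IntegralRep n), 0 < ε ∧
        (∃ c₀ : ℚ, c₀ ≠ 0 ∧ ∀ z : Fin n → ℝ,
          MvPolynomial.aeval (Fin.snoc z (0 : ℝ) : Fin (n + 1) → ℝ) Q = (c₀ : ℝ)) ∧
        (∀ (z : Fin n → ℝ) (ϖ : ℝ), (∀ i, z i ∈ Set.Icc (0 : ℝ) 1) → ϖ ∈ Set.Ioo 0 ε →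
          MvPolynomial.aeval (Fin.snoc z ϖ : Fin (n + 1) → ℝ) Q ≠ 0) ∧
        (∀ ϖ ∈ Set.Ioo (0 : ℝ) ε, ∫ z in Set.pi Set.univ (fun _ : Fin n => Set.Ioo (0 : ℝ) 1),
          MvPolynomial.aeval (Fin.snoc z ϖ : Fin (n + 1) → ℝ) P /
            MvPolynomial.aeval (Fin.snoc z ϖ : Fin (n + 1) → ℝ) Q = 0) ∧
        IsAlgebraic ℚ ϖ₀ ∧ ϖ₀ ∈ Set.Ioo 0 ε ∧
        r.domain = Set.pi Set.univ (fun _ : Fin n => Set.Ioo (0 : ℝ) 1) ∧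
        Set.EqOn r.integrand (fun z => MvPolynomial.aeval (Fin.snoc z ϖ₀ : Fin (n + 1) → ℝ) P /
          MvPolynomial.aeval (Fin.snoc z ϖ₀ : Fin (n + 1) → ℝ) Q) r.domain ∧
        d = KZ.of r} := by
  refine tateLifting_volumeFormLift _ le_sup_left (sup_le KZ.relations_le_ker_eval_holds ?_)
  refine (AddSubgroup.closure_le _).2 ?_
  rintro d ⟨n, P, Q, ε, ϖ₀, r, -, -, -, hV, -, hϖ₀, hdom, heq, rfl⟩
  rw [SetLike.mem_coe, AddMonoidHom.mem_ker, KZ.eval_of]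
  show ∫ x in r.domain, r.integrand x = 0
  rw [MeasureTheory.setIntegral_congr_fun (KZ.IntegralRep.measurableSet_domain_holds r) heq, hdom]
  exact hV ϖ₀ hϖ₀

/-- **Conjecture 1 (kernel form) iff the Cresson–Viu-Sos volume conjecture** (`tateLifting_volumeFormLift` at
`G = relations`, over the tree's `KZ.semiCanonicalReduction_holds`). [cite: CressonViusos2022, §1 p. 326] -/
theorem kzKernelConjecture_iff_volumeConjectureCompact :
    KZKernelConjecture ↔ KZ.volumeConjectureCompact := by
  have h := tateLifting_volumeFormLift KZ.relations le_rfl KZ.relations_le_ker_eval_holds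
  constructor
  · intro hK d K₁ K₂ h1c h1i h2c h2i h11 h21 hv
    exact h.1 hK d K₁ K₂ h1c h1i h2c h2i h11 h21 hv
  · intro hv c hc
    exact h.2 (fun d K₁ K₂ h1c h1i h2c h2i h11 h21 hval => hv K₁ K₂ h1c h1i h2c h2i h11 h21 hval) c hc

end Summit.KontsevichZagierPeriods.InverseLandau
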